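import Summits.QuantumFields.YangMills.Theorems.BalabanUVNodesK0Stub3V20RunSockets
import Summits.QuantumFields.YangMills.Theorems.BalabanUVNodesK0Stub3BoxOfKernelLetters
import Summits.QuantumFields.YangMills.Theorems.BalabanUVNodesK0Stub3FinVolFace

/-!
# K0⁷ — STUB 3 UNDER THE V20 TEXTS, PART 3: the lane's three kernel-level CURRENCIES re-keyed to ONE REPRESENTATIVE PER THRESHOLD `a₀` (letter-blindness), each paying the token-free core —
# hence V19's 3ᴬ′, V20-R, V20-G∕G♭ and the 3ᴿ twins AT ONCE — and K0⁷ BY NAME from each under V19's stub-1 text and under the V20-R stub-1 text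

Cell `pub-ymgap`, width seat `pub-ymgap-k0-s3-w2` (g3; director-ym R399 (3a) ∕ №207; bus CLAIM-3 = this file).  `--kind proof --supports stmt-QuantumFields-20541 --as helper` (count-neutral).
NEW leaf; theorems only; 0 `def`; nothing modified; no registry write.  Imports `…K0Stub3V20RunSockets` (this seat, FILE 2 → FILE 1 p632040), `…K0Stub3BoxOfKernelLetters` (k0-s3-w1 g0 p610322 →
`…K0Stub3RunwiseSuppliers` p608074), `…K0Stub3FinVolFace` (k0-s3-w2 g2 p613354).  [15] = [Balaban1985Variational]; [6] = [Balaban1985RegularSpaces]; [I] = [Balaban1987RG1]; [II] = [Balaban1989LargeFieldII].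

WHY.  The stub-3 lane's currency files (LANE-MAP `HOME/pub-ymgap-k0-s3-w1/K0S3-LANE-MAP.md` §1) each end in a road «letters at `θ₁₅ᶜᶜᴹ(j; ε₀, ε₂₉; B₃, B₃′, a₀, a₁)` for EVERY admissible tuple ⟹
V19's registered socket» (`abs3A'_of_kernelLettersAt` p610322, `absBetaBoxGenAt_of_kernelDecayWindowUniformAt` p608074, `abs3A'_of_fundamentalDomainFaceAt` p613354).  Two things changed since:
(i) `…K0Stub3CubeLetterBlind` §1 (p608905): the β of record at A1's witness reads only `(a₀, ε₂₉)` — so ONE inhabited representative `(j, ε₀, B₃, B₃′, a₁)` PER THRESHOLD `a₀` suffices;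
(ii) plan g86's WORD V20 = G (bus I.37134) re-letters the socket's antecedents, and `…K0Stub3V20Sockets` §3 shows the TOKEN-FREE core pays every text.  THIS FILE states each currency's bill in the
weakest by-name form the tree now supports — «for every `a₀ > 0`, the letters at ONE witness» — and derives the token-free core (§1–§3, through FILE 1∕2's road schemas and the currency files'
θ-generic roads `absBetaBox_betaOfRecord₁₃_of_kernelNE9_of_kernelDecay`, `absBetaBox_of_kernelDecayWindowUniform`, `absBox_betaOfRecord₁₃_of_fundamentalDomainDecayOnBox`), then K0⁷ BY NAME
under V19's stub-1 text (`…CubeLetterBlind.record13SepCoPHInhabited_of_stub1_tokenFreeCore_byName`) and under the V20-R stub-1 text (`…V20Sockets.record13SepCoPHInhabited_of_stub1R_tokenFree_byName`)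
(§4).  The V20-G stub-1 hub keys on k0-s1-w3 g7's G composition when it lands.

HONEST FRAMING.  By-name plumbing; NO β estimate; nothing of Bałaban asserted; every kernel letter ∕ (5.10) decay ∕ finite-volume letter below is a HYPOTHESIS inhabited nowhere (NODE O ∕
N22 ∕ N18 ∕ (D4) ∕ def-W1 owners); 3ᴬ′ (any text) NOT proved; K0⁷ stmt-QuantumFields-20541 OPEN (V19 STANDS; V20-G is the plan's registration); counts unmoved (typed 28∕28 · discharged 5∕27,
A 5∕28 — the chair's words).  One finite 𝕋⁴ programme at fixed `ε = L^{−K}`, Bałaban AS PRINTED — NOT continuum ∕ ℝ⁴ ∕ OS ∕ mass gap ∕ Clay (the Yang–Mills mass gap is NOT proved by any of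
this; route R4 closes the CONDITIONAL finite-𝕋⁴ rung `BalabanLadder.UV` only).  No `sorry`, `def`, `instance`, `notation`, `axiom`.
-/

noncomputable section

open scoped Matrix.Norms.L2Operator

namespace Summit.QuantumFields.YangMills.Theorems.K0Stub3V20CurrencyRoads

open Literature.MathematicalPhysics.QuantumFieldTheory.Balaban1983to89
open Literature.MathematicalPhysics.QuantumFieldTheory.Balaban1983to89.Node00
open Literature.MathematicalPhysics.QuantumFieldTheory.Balaban1983to89.T4Continuum
open Literature.MathematicalPhysics.QuantumFieldTheory.Balaban1983to89.FlowStep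
open Literature.MathematicalPhysics.QuantumFieldTheory.Balaban1983to89.T4OutputRate (Window NE9)
open Literature.MathematicalPhysics.QuantumFieldTheory.Balaban1983to89.B12Sec2to5 (l1 Decay510 betaPrime510)
open Literature.MathematicalPhysics.QuantumFieldTheory.Balaban1983to89.Node00.U3OfKernels (kernelA objectsOfRecord₁₃ KernelDecayOfRecord₁₃)
open Literature.MathematicalPhysics.QuantumFieldTheory.Balaban1983to89.Node00.U3KernelLetters (PolLimitsExistBox)
open Summit.QuantumFields.YangMills.Theorems.K0V19Defs (Prop8StepCoPAt AbsBetaBoxAtThm1WitnessCCMGenAt)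
open Summit.QuantumFields.YangMills.Theorems.K0Stub3CubeLetterBlind (absBetaBoxGenAt_of_tokenFree record13SepCoPHInhabited_of_stub1_tokenFreeCore_byName)
open Summit.QuantumFields.YangMills.Theorems.K0Stub3RunwiseSuppliers (absBetaBox_of_kernelDecayWindowUniform)
open Summit.QuantumFields.YangMills.Theorems.K0Stub3BoxOfKernelLetters (absBetaBox_betaOfRecord₁₃_of_kernelNE9_of_kernelDecay)
open Summit.QuantumFields.YangMills.Theorems.K0Stub3FinVolFace (absBox_betaOfRecord₁₃_of_fundamentalDomainDecayOnBox)
open Summit.QuantumFields.YangMills.Theorems.K0Stub3V20Sockets (abs3A'R_of_tokenFree abs3A'G_of_tokenFree record13SepCoPHInhabited_of_stub1R_tokenFree_byName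
  tokenFree_of_genericRoadAtWindowWitness)
open Summit.QuantumFields.YangMills.Theorems.K0Stub3V20RunSockets (tokenFree_of_genericRoadAtWitness run3RR_of_tokenFree)

variable (F : T4Family)

/-! ## §1  KERNEL LETTERS (p610322's package: NE9 on the witness's window + fading memory + (5.10) decay of the limiting kernels) at ONE witness per threshold -/

section KernelLetters

/-- **★ THE KERNEL-LETTER BILL, ONE REPRESENTATIVE PER THRESHOLD, PAYS THE TOKEN-FREE CORE**: if for every `a₀ > 0` SOME witness `θ₁₅ᶜᶜᴹ(j; ε₀, ε₂₉; B₃, B₃′, a₀, a₁)` (any one cube letter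
and constants, `0 < ε₂₉`) carries N22's `NE9` on its window with summable (fading-memory) rows and (D4)'s `KernelDecayOfRecord₁₃ … 0 1 κ` — p610322's `abs3A'_of_kernelLettersAt` asked this for
EVERY `(j, B₃, B₃′, a₀, a₁)` — then the token-free box core holds at `F` (road `absBetaBox_betaOfRecord₁₃_of_kernelNE9_of_kernelDecay`, θ-generic; `θ.γ = ½ > 0` at the witness; FILE 2's
schema spreads the box by letter-blindness).  CONDITIONAL on the letters (displayed, inhabited nowhere); nothing of Bałaban asserted.
[cite: Balaban1987RG1, Thm 1 p.259, (1.18) p.263, (1.20)–(1.22) p.264, (5.10) p.293; Balaban1988RG2Cluster, (2.13)–(2.14) pp.14–15; Balaban1989LargeFieldII, p.355] -/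
theorem tokenFree_of_kernelLettersAtOneWitness
    (hK : ∀ a₀ : ℝ, 0 < a₀ → ∃ (j : ℕ) (ε₀ ε₂₉ B₃ B₃' a₁ : ℝ), 0 < ε₂₉ ∧
      ∃ (ℓ : U3Letters₁₁) (κ C₉ ω : ℝ) (Λ : ℕ → ℕ → ℝ), 0 < κ ∧ 0 ≤ ω ∧ ω < 1 ∧
        NE9 ((objectsOfRecord₁₃ F 2 (theta13OfThm1CCM F 2 j ε₀ ε₂₉ B₃ B₃' a₀ a₁) ℓ).EA 0) (Window (theta13OfThm1CCM F 2 j ε₀ ε₂₉ B₃ B₃' a₀ a₁).γ) κ Λ ∧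
        T4OutputRate.FadingMemory C₉ ω Λ ∧
        KernelDecayOfRecord₁₃ F 2 (theta13OfThm1CCM F 2 j ε₀ ε₂₉ B₃ B₃' a₀ a₁) 0 1 κ) :
    ∀ a₀ : ℝ, 0 < a₀ → ∃ γ₀ ε₂₉ β' : ℝ, 0 < γ₀ ∧ 0 < ε₂₉ ∧ ∀ (j : ℕ) (ε₀ B₃ B₃' a₁ : ℝ),
      BetaLowerH (-β') γ₀ (betaOfRecord₁₃ F 2 (theta13OfThm1CCM F 2 j ε₀ ε₂₉ B₃ B₃' a₀ a₁)) ∧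
      BetaUpperH β' γ₀ (betaOfRecord₁₃ F 2 (theta13OfThm1CCM F 2 j ε₀ ε₂₉ B₃ B₃' a₀ a₁)) := by
  refine tokenFree_of_genericRoadAtWitness F
    (fun θ => 0 < θ.γ ∧ ∃ (ℓ : U3Letters₁₁) (κ C₉ ω : ℝ) (Λ : ℕ → ℕ → ℝ), 0 < κ ∧ 0 ≤ ω ∧ ω < 1 ∧
      NE9 ((objectsOfRecord₁₃ F 2 θ ℓ).EA 0) (Window θ.γ) κ Λ ∧ T4OutputRate.FadingMemory C₉ ω Λ ∧ KernelDecayOfRecord₁₃ F 2 θ 0 1 κ)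
    (fun θ hP => ?_) (fun a₀ ha₀ => ?_)
  · obtain ⟨hγ, ℓ, κ, C₉, ω, Λ, hκ, hω0, hω1, h9, hΛ, hdec⟩ := hP
    obtain ⟨β', hlow, hup⟩ := absBetaBox_betaOfRecord₁₃_of_kernelNE9_of_kernelDecay F 2 θ ℓ hκ hγ h9 hΛ hω0 hω1 hdec
    exact ⟨θ.γ, β', hγ, hlow, hup⟩
  · obtain ⟨j, ε₀, ε₂₉, B₃, B₃', a₁, hε', ℓ, κ, C₉, ω, Λ, hκ, hω0, hω1, h9, hΛ, hdec⟩ := hK a₀ ha₀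
    refine ⟨j, ε₀, ε₂₉, B₃, B₃', a₁, hε', ?_, ℓ, κ, C₉, ω, Λ, hκ, hω0, hω1, h9, hΛ, hdec⟩
    rw [theta13OfThm1CCM_γ]; norm_num


/-- **★ THE SMALL-WINDOW EDITION: KERNEL LETTERS AT ONE WINDOW WITNESS `θ₁₅ᶜᶜᴹᵂ(j; γ₀)` PER THRESHOLD** (`0 < γ₀ ≤ ½`; NE9 read on `Window γ₀`, NOT on `Window ½` — p618788's point): the same
θ-generic road at `θ := θ₁₅ᶜᶜᴹᵂ(j; γ₀, …)` returns the `γ₀`-box, FILE 1's window schema transfers it to A1's witness and spreads it.  CONDITIONAL on the letters; nothing of Bałaban asserted.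
[cite: Balaban1987RG1, Thm 1 p.255, (1.18) p.263, (1.20)–(1.22) p.264, (5.10) p.293; Balaban1988RG2Cluster, (2.13)–(2.14) pp.14–15; Balaban1989LargeFieldII, (1.4) p.357, p.355] -/
theorem tokenFree_of_kernelLettersAtOneWindowWitness
    (hK : ∀ a₀ : ℝ, 0 < a₀ → ∃ (j : ℕ) (γ₀ ε₀ ε₂₉ B₃ B₃' a₁ : ℝ), 0 < γ₀ ∧ γ₀ ≤ 1 / 2 ∧ 0 < ε₂₉ ∧
      ∃ (ℓ : U3Letters₁₁) (κ C₉ ω : ℝ) (Λ : ℕ → ℕ → ℝ), 0 < κ ∧ 0 ≤ ω ∧ ω < 1 ∧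
        NE9 ((objectsOfRecord₁₃ F 2 (theta13OfThm1CCMW F 2 j γ₀ ε₀ ε₂₉ B₃ B₃' a₀ a₁) ℓ).EA 0) (Window (theta13OfThm1CCMW F 2 j γ₀ ε₀ ε₂₉ B₃ B₃' a₀ a₁).γ) κ Λ ∧
        T4OutputRate.FadingMemory C₉ ω Λ ∧
        KernelDecayOfRecord₁₃ F 2 (theta13OfThm1CCMW F 2 j γ₀ ε₀ ε₂₉ B₃ B₃' a₀ a₁) 0 1 κ) :
    ∀ a₀ : ℝ, 0 < a₀ → ∃ γ₀ ε₂₉ β' : ℝ, 0 < γ₀ ∧ 0 < ε₂₉ ∧ ∀ (j : ℕ) (ε₀ B₃ B₃' a₁ : ℝ),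
      BetaLowerH (-β') γ₀ (betaOfRecord₁₃ F 2 (theta13OfThm1CCM F 2 j ε₀ ε₂₉ B₃ B₃' a₀ a₁)) ∧
      BetaUpperH β' γ₀ (betaOfRecord₁₃ F 2 (theta13OfThm1CCM F 2 j ε₀ ε₂₉ B₃ B₃' a₀ a₁)) := by
  refine tokenFree_of_genericRoadAtWindowWitness F
    (fun θ => ∃ (ℓ : U3Letters₁₁) (κ C₉ ω : ℝ) (Λ : ℕ → ℕ → ℝ), 0 < κ ∧ 0 ≤ ω ∧ ω < 1 ∧
      NE9 ((objectsOfRecord₁₃ F 2 θ ℓ).EA 0) (Window θ.γ) κ Λ ∧ T4OutputRate.FadingMemory C₉ ω Λ ∧ KernelDecayOfRecord₁₃ F 2 θ 0 1 κ)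
    (fun θ hP hγ => ?_) (fun a₀ ha₀ => ?_)
  · obtain ⟨ℓ, κ, C₉, ω, Λ, hκ, hω0, hω1, h9, hΛ, hdec⟩ := hP
    exact absBetaBox_betaOfRecord₁₃_of_kernelNE9_of_kernelDecay F 2 θ ℓ hκ hγ h9 hΛ hω0 hω1 hdec
  · obtain ⟨j, γ₀, ε₀, ε₂₉, B₃, B₃', a₁, hγ₀, hγh, hε', hrest⟩ := hK a₀ ha₀
    exact ⟨j, γ₀, ε₀, ε₂₉, B₃, B₃', a₁, hγ₀, hγh, hε', hrest⟩

/-- **THE SAME BILL PAYS V19's REGISTERED 3ᴬ′** `K0V19Defs.AbsBetaBoxAtThm1WitnessCCMGenAt F` (p608905's `absBetaBoxGenAt_of_tokenFree`) — p610322's socket theorem with its hypothesis weakened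
to one representative per threshold.  CONDITIONAL. [cite: Balaban1987RG1, Thm 1 p.259, (1.18) p.263, (1.20)–(1.22) p.264, (5.10) p.293; Balaban1988RG2Cluster, (2.13)–(2.14) pp.14–15; Balaban1989LargeFieldII, p.355] -/
theorem abs3A'V19_of_kernelLettersAtOneWitness
    (hK : ∀ a₀ : ℝ, 0 < a₀ → ∃ (j : ℕ) (ε₀ ε₂₉ B₃ B₃' a₁ : ℝ), 0 < ε₂₉ ∧
      ∃ (ℓ : U3Letters₁₁) (κ C₉ ω : ℝ) (Λ : ℕ → ℕ → ℝ), 0 < κ ∧ 0 ≤ ω ∧ ω < 1 ∧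
        NE9 ((objectsOfRecord₁₃ F 2 (theta13OfThm1CCM F 2 j ε₀ ε₂₉ B₃ B₃' a₀ a₁) ℓ).EA 0) (Window (theta13OfThm1CCM F 2 j ε₀ ε₂₉ B₃ B₃' a₀ a₁).γ) κ Λ ∧
        T4OutputRate.FadingMemory C₉ ω Λ ∧
        KernelDecayOfRecord₁₃ F 2 (theta13OfThm1CCM F 2 j ε₀ ε₂₉ B₃ B₃' a₀ a₁) 0 1 κ) :
    AbsBetaBoxAtThm1WitnessCCMGenAt F :=
  absBetaBoxGenAt_of_tokenFree F (tokenFree_of_kernelLettersAtOneWitness F hK)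

/-- **… AND THE PLAN's V20-G 3ᴬ′ TEXT** (`…V20Sockets.abs3A'G_of_tokenFree`; the R and G♭ texts likewise through `abs3A'R_of_tokenFree` ∕ `abs3A'Gb_of_abs3A'G`).  CONDITIONAL.
[cite: Balaban1987RG1, Thm 1 p.259, (1.20)–(1.22) p.264, (5.10) p.293, (0.1) p.251; Balaban1985Variational, Thm 1 (8)–(9) p.279, p.304 lines 1–2; Balaban1989LargeFieldII, p.355] -/
theorem abs3A'G_of_kernelLettersAtOneWitness
    (hK : ∀ a₀ : ℝ, 0 < a₀ → ∃ (j : ℕ) (ε₀ ε₂₉ B₃ B₃' a₁ : ℝ), 0 < ε₂₉ ∧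
      ∃ (ℓ : U3Letters₁₁) (κ C₉ ω : ℝ) (Λ : ℕ → ℕ → ℝ), 0 < κ ∧ 0 ≤ ω ∧ ω < 1 ∧
        NE9 ((objectsOfRecord₁₃ F 2 (theta13OfThm1CCM F 2 j ε₀ ε₂₉ B₃ B₃' a₀ a₁) ℓ).EA 0) (Window (theta13OfThm1CCM F 2 j ε₀ ε₂₉ B₃ B₃' a₀ a₁).γ) κ Λ ∧
        T4OutputRate.FadingMemory C₉ ω Λ ∧
        KernelDecayOfRecord₁₃ F 2 (theta13OfThm1CCM F 2 j ε₀ ε₂₉ B₃ B₃' a₀ a₁) 0 1 κ) :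
    ∀ (j c c₀ : ℕ) (B₃ B₃' a₀ a₁ : ℝ), c ≤ F.L ^ j → 2 * (F.L : ℝ) ^ 2 ≤ B₃ → 0 < B₃' → 0 < a₀ → 0 < a₁ →
      VariationalThm1RegSepCoP7MG F 2 (fun ν _M _g K k _s => c ≤ ν.M₁ ∧ k + c₀ ≤ F.m + K) B₃ a₀ a₁ →
      Gauge9RegSepTopStepG F 2 (fun ν K Ω => suppDomOfRecord F ν K Ω) (F.L ^ j) (fun ν _M _g K k _s => c ≤ ν.M₁ ∧ k + c₀ ≤ F.m + K) B₃ B₃' a₀ a₁ →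
      ∃ γ₀ ε₀ ε₂₉ β' : ℝ, 0 < γ₀ ∧ 0 < ε₀ ∧ 0 < ε₂₉ ∧
        BetaLowerH (-β') γ₀ (betaOfRecord₁₃ F 2 (theta13OfThm1CCM F 2 j ε₀ ε₂₉ B₃ B₃' a₀ a₁)) ∧
        BetaUpperH β' γ₀ (betaOfRecord₁₃ F 2 (theta13OfThm1CCM F 2 j ε₀ ε₂₉ B₃ B₃' a₀ a₁)) :=
  abs3A'G_of_tokenFree F (tokenFree_of_kernelLettersAtOneWitness F hK)

end KernelLetters

/-! ## §2  WINDOW-UNIFORM (5.10) DECAY of the limiting kernels on `Window γ₀` (p608074's currency) at ONE witness per threshold -/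

section WindowUniform

/-- **★ THE WINDOW-UNIFORM (5.10) BILL, ONE REPRESENTATIVE PER THRESHOLD, PAYS THE TOKEN-FREE CORE**: if for every `a₀ > 0` SOME witness `θ₁₅ᶜᶜᴹ(j; …; a₀, …)` (`0 < ε₂₉`) has ONE
`(C, δ₁ > 0)` and a window `0 < γ₀ ≤ ½` with `Decay510 (Π_{k+1}(g; ·)_{01}) C δ₁` for every `g ∈ Window γ₀` and every `k` ([I] (5.10) for the LIMITING kernels of record, print's own statement) —
p608074's `absBetaBoxGenAt_of_kernelDecayWindowUniformAt` asked this for EVERY admissible tuple — then the token-free box core holds at `F` (`β′ = β′₅₁₀(4; C, δ₁)`, road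
`absBetaBox_of_kernelDecayWindowUniform`).  CONDITIONAL on the decay (displayed, inhabited nowhere); nothing of Bałaban asserted.
[cite: Balaban1987RG1, Thm 1 p.259, (1.20)–(1.22) p.264, §1 p.264, (5.10) p.293; Balaban1989LargeFieldII, p.355] -/
theorem tokenFree_of_kernelDecayWindowUniformAtOneWitness
    (hdec : ∀ a₀ : ℝ, 0 < a₀ → ∃ (j : ℕ) (ε₀ ε₂₉ B₃ B₃' a₁ : ℝ), 0 < ε₂₉ ∧ ∃ γ₀ C δ₁ : ℝ, 0 < γ₀ ∧ γ₀ ≤ 1 / 2 ∧ 0 < δ₁ ∧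
      (letI := (theta13OfThm1CCM F 2 j ε₀ ε₂₉ B₃ B₃' a₀ a₁).instVβ₁; letI := (theta13OfThm1CCM F 2 j ε₀ ε₂₉ B₃ B₃' a₀ a₁).instVβ₂;
       letI := (theta13OfThm1CCM F 2 j ε₀ ε₂₉ B₃ B₃' a₀ a₁).instιβ
       ∀ g ∈ Window γ₀, ∀ k : ℕ,
         Decay510 (kernelA F (mergedTermFamilyMatT F 2 (TβOfRecord₁₃ F 2) (chiβOfRecord₁₃ F 2 (theta13OfThm1CCM F 2 j ε₀ ε₂₉ B₃ B₃' a₀ a₁))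
           (theta13OfThm1CCM F 2 j ε₀ ε₂₉ B₃ B₃' a₀ a₁).εbg) (theta13OfThm1CCM F 2 j ε₀ ε₂₉ B₃ B₃' a₀ a₁).ρ8 (theta13OfThm1CCM F 2 j ε₀ ε₂₉ B₃ B₃' a₀ a₁).bV g k 0 1) C δ₁)) :
    ∀ a₀ : ℝ, 0 < a₀ → ∃ γ₀ ε₂₉ β' : ℝ, 0 < γ₀ ∧ 0 < ε₂₉ ∧ ∀ (j : ℕ) (ε₀ B₃ B₃' a₁ : ℝ),
      BetaLowerH (-β') γ₀ (betaOfRecord₁₃ F 2 (theta13OfThm1CCM F 2 j ε₀ ε₂₉ B₃ B₃' a₀ a₁)) ∧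
      BetaUpperH β' γ₀ (betaOfRecord₁₃ F 2 (theta13OfThm1CCM F 2 j ε₀ ε₂₉ B₃ B₃' a₀ a₁)) := by
  refine tokenFree_of_genericRoadAtWitness F
    (fun θ => ∃ γ₀ C δ₁ : ℝ, 0 < γ₀ ∧ γ₀ ≤ θ.γ ∧ 0 < δ₁ ∧
      (letI := θ.instVβ₁; letI := θ.instVβ₂; letI := θ.instιβ
       ∀ g ∈ Window γ₀, ∀ k : ℕ,
         Decay510 (kernelA F (mergedTermFamilyMatT F 2 (TβOfRecord₁₃ F 2) (chiβOfRecord₁₃ F 2 θ) θ.εbg) θ.ρ8 θ.bV g k 0 1) C δ₁))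
    (fun θ hP => ?_) (fun a₀ ha₀ => ?_)
  · obtain ⟨γ₀, C, δ₁, hγ₀, hle, hδ, hd⟩ := hP
    obtain ⟨hlow, hup⟩ := absBetaBox_of_kernelDecayWindowUniform F 2 θ hδ hle hd
    exact ⟨γ₀, betaPrime510 4 C δ₁, hγ₀, hlow, hup⟩
  · obtain ⟨j, ε₀, ε₂₉, B₃, B₃', a₁, hε', γ₀, C, δ₁, hγ₀, hγh, hδ, hd⟩ := hdec a₀ ha₀
    refine ⟨j, ε₀, ε₂₉, B₃, B₃', a₁, hε', γ₀, C, δ₁, hγ₀, ?_, hδ, hd⟩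
    rw [theta13OfThm1CCM_γ]; exact hγh

/-- **THE SAME BILL PAYS V19's REGISTERED 3ᴬ′** (p608074's `absBetaBoxGenAt_of_kernelDecayWindowUniformAt` with its hypothesis weakened to one representative per threshold).  CONDITIONAL.
[cite: Balaban1987RG1, Thm 1 p.259, (1.20)–(1.22) p.264, §1 p.264, (5.10) p.293; Balaban1989LargeFieldII, p.355] -/
theorem abs3A'V19_of_kernelDecayWindowUniformAtOneWitness
    (hdec : ∀ a₀ : ℝ, 0 < a₀ → ∃ (j : ℕ) (ε₀ ε₂₉ B₃ B₃' a₁ : ℝ), 0 < ε₂₉ ∧ ∃ γ₀ C δ₁ : ℝ, 0 < γ₀ ∧ γ₀ ≤ 1 / 2 ∧ 0 < δ₁ ∧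
      (letI := (theta13OfThm1CCM F 2 j ε₀ ε₂₉ B₃ B₃' a₀ a₁).instVβ₁; letI := (theta13OfThm1CCM F 2 j ε₀ ε₂₉ B₃ B₃' a₀ a₁).instVβ₂;
       letI := (theta13OfThm1CCM F 2 j ε₀ ε₂₉ B₃ B₃' a₀ a₁).instιβ
       ∀ g ∈ Window γ₀, ∀ k : ℕ,
         Decay510 (kernelA F (mergedTermFamilyMatT F 2 (TβOfRecord₁₃ F 2) (chiβOfRecord₁₃ F 2 (theta13OfThm1CCM F 2 j ε₀ ε₂₉ B₃ B₃' a₀ a₁))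
           (theta13OfThm1CCM F 2 j ε₀ ε₂₉ B₃ B₃' a₀ a₁).εbg) (theta13OfThm1CCM F 2 j ε₀ ε₂₉ B₃ B₃' a₀ a₁).ρ8 (theta13OfThm1CCM F 2 j ε₀ ε₂₉ B₃ B₃' a₀ a₁).bV g k 0 1) C δ₁)) :
    AbsBetaBoxAtThm1WitnessCCMGenAt F :=
  absBetaBoxGenAt_of_tokenFree F (tokenFree_of_kernelDecayWindowUniformAtOneWitness F hdec)

/-- **… AND THE PLAN's V20-G 3ᴬ′ TEXT.**  CONDITIONAL. [cite: Balaban1987RG1, Thm 1 p.259, (1.20)–(1.22) p.264, (5.10) p.293, (0.1) p.251; Balaban1985Variational, Thm 1 (8)–(9) p.279, p.304 lines 1–2; Balaban1989LargeFieldII, p.355] -/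
theorem abs3A'G_of_kernelDecayWindowUniformAtOneWitness
    (hdec : ∀ a₀ : ℝ, 0 < a₀ → ∃ (j : ℕ) (ε₀ ε₂₉ B₃ B₃' a₁ : ℝ), 0 < ε₂₉ ∧ ∃ γ₀ C δ₁ : ℝ, 0 < γ₀ ∧ γ₀ ≤ 1 / 2 ∧ 0 < δ₁ ∧
      (letI := (theta13OfThm1CCM F 2 j ε₀ ε₂₉ B₃ B₃' a₀ a₁).instVβ₁; letI := (theta13OfThm1CCM F 2 j ε₀ ε₂₉ B₃ B₃' a₀ a₁).instVβ₂;
       letI := (theta13OfThm1CCM F 2 j ε₀ ε₂₉ B₃ B₃' a₀ a₁).instιβ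
       ∀ g ∈ Window γ₀, ∀ k : ℕ,
         Decay510 (kernelA F (mergedTermFamilyMatT F 2 (TβOfRecord₁₃ F 2) (chiβOfRecord₁₃ F 2 (theta13OfThm1CCM F 2 j ε₀ ε₂₉ B₃ B₃' a₀ a₁))
           (theta13OfThm1CCM F 2 j ε₀ ε₂₉ B₃ B₃' a₀ a₁).εbg) (theta13OfThm1CCM F 2 j ε₀ ε₂₉ B₃ B₃' a₀ a₁).ρ8 (theta13OfThm1CCM F 2 j ε₀ ε₂₉ B₃ B₃' a₀ a₁).bV g k 0 1) C δ₁)) :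
    ∀ (j c c₀ : ℕ) (B₃ B₃' a₀ a₁ : ℝ), c ≤ F.L ^ j → 2 * (F.L : ℝ) ^ 2 ≤ B₃ → 0 < B₃' → 0 < a₀ → 0 < a₁ →
      VariationalThm1RegSepCoP7MG F 2 (fun ν _M _g K k _s => c ≤ ν.M₁ ∧ k + c₀ ≤ F.m + K) B₃ a₀ a₁ →
      Gauge9RegSepTopStepG F 2 (fun ν K Ω => suppDomOfRecord F ν K Ω) (F.L ^ j) (fun ν _M _g K k _s => c ≤ ν.M₁ ∧ k + c₀ ≤ F.m + K) B₃ B₃' a₀ a₁ →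
      ∃ γ₀ ε₀ ε₂₉ β' : ℝ, 0 < γ₀ ∧ 0 < ε₀ ∧ 0 < ε₂₉ ∧
        BetaLowerH (-β') γ₀ (betaOfRecord₁₃ F 2 (theta13OfThm1CCM F 2 j ε₀ ε₂₉ B₃ B₃' a₀ a₁)) ∧
        BetaUpperH β' γ₀ (betaOfRecord₁₃ F 2 (theta13OfThm1CCM F 2 j ε₀ ε₂₉ B₃ B₃' a₀ a₁)) :=
  abs3A'G_of_tokenFree F (tokenFree_of_kernelDecayWindowUniformAtOneWitness F hdec)

end WindowUniform

/-! ## §3  THE FUNDAMENTAL-DOMAIN FINITE-VOLUME FACE (p613354: (L) `PolLimitsExistBox` + (FD) ONE `(C, δ₁)` on the centred fundamental window of every torus) at ONE witness per threshold -/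

section FundamentalDomain

/-- **★ THE FUNDAMENTAL-DOMAIN BILL, ONE REPRESENTATIVE PER THRESHOLD, PAYS THE TOKEN-FREE CORE**: if for every `a₀ > 0` SOME witness `θ₁₅ᶜᶜᴹ(j; …; a₀, …)` (`0 < ε₂₉`) has a window
`0 < γ₀ ≤ ½`, the existence of the printed limits (1.21) on it (def-W1's `PolLimitsExistBox … γ₀`) and ONE `(C, δ₁ > 0)` with `|Π_K(v; z)| ≤ C e^{−δ₁|z|₁}` for every `k`, `v ∈ ]0, γ₀]^{k+1}`, `K`
and every `z` in the centred fundamental window `2|z_i| < sitesPerDir (k+1)` (print's torus reading of (5.10)) — p613354's `abs3A'_of_fundamentalDomainFaceAt` asked this for EVERY admissible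
tuple — then the token-free box core holds at `F` (road `absBox_betaOfRecord₁₃_of_fundamentalDomainDecayOnBox`, `β′ = β′₅₁₀(4; C, δ₁)`).  CONDITIONAL on (L) ∧ (FD) (displayed, inhabited
nowhere); nothing of Bałaban asserted. [cite: Balaban1987RG1, Thm 1 p.259, (1.20)–(1.22) p.264, §1 p.264, (5.10) p.293; Balaban1989LargeFieldII, p.355] -/
theorem tokenFree_of_fundamentalDomainFaceAtOneWitness
    (h : ∀ a₀ : ℝ, 0 < a₀ → ∃ (j : ℕ) (ε₀ ε₂₉ B₃ B₃' a₁ : ℝ), 0 < ε₂₉ ∧ ∃ γ₀ C δ₁ : ℝ, 0 < γ₀ ∧ γ₀ ≤ 1 / 2 ∧ 0 < δ₁ ∧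
      (letI := (theta13OfThm1CCM F 2 j ε₀ ε₂₉ B₃ B₃' a₀ a₁).instVβ₁; letI := (theta13OfThm1CCM F 2 j ε₀ ε₂₉ B₃ B₃' a₀ a₁).instVβ₂;
       letI := (theta13OfThm1CCM F 2 j ε₀ ε₂₉ B₃ B₃' a₀ a₁).instιβ
       PolLimitsExistBox F
          (mergedTermFamilyMatT F 2 (TβOfRecord₁₃ F 2) (chiβOfRecord₁₃ F 2 (theta13OfThm1CCM F 2 j ε₀ ε₂₉ B₃ B₃' a₀ a₁)) (theta13OfThm1CCM F 2 j ε₀ ε₂₉ B₃ B₃' a₀ a₁).εbg)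
          (theta13OfThm1CCM F 2 j ε₀ ε₂₉ B₃ B₃' a₀ a₁).ρ8 (theta13OfThm1CCM F 2 j ε₀ ε₂₉ B₃ B₃' a₀ a₁).bV γ₀ ∧
       (∀ k (v : Fin (k + 1) → ℝ), v ∈ Box γ₀ k → ∀ K (z : Fin 4 → ℤ), (∀ i, 2 * |z i| < ((F.P K).sitesPerDir (k + 1) : ℤ)) →
          |polWindow F K (k + 1)
              (mergedTermFamilyMatT F 2 (TβOfRecord₁₃ F 2) (chiβOfRecord₁₃ F 2 (theta13OfThm1CCM F 2 j ε₀ ε₂₉ B₃ B₃' a₀ a₁)) (theta13OfThm1CCM F 2 j ε₀ ε₂₉ B₃ B₃' a₀ a₁).εbg k v K)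
              (theta13OfThm1CCM F 2 j ε₀ ε₂₉ B₃ B₃' a₀ a₁).ρ8 (theta13OfThm1CCM F 2 j ε₀ ε₂₉ B₃ B₃' a₀ a₁).bV 0 1 z| ≤ C * Real.exp (-δ₁ * l1 z)))) :
    ∀ a₀ : ℝ, 0 < a₀ → ∃ γ₀ ε₂₉ β' : ℝ, 0 < γ₀ ∧ 0 < ε₂₉ ∧ ∀ (j : ℕ) (ε₀ B₃ B₃' a₁ : ℝ),
      BetaLowerH (-β') γ₀ (betaOfRecord₁₃ F 2 (theta13OfThm1CCM F 2 j ε₀ ε₂₉ B₃ B₃' a₀ a₁)) ∧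
      BetaUpperH β' γ₀ (betaOfRecord₁₃ F 2 (theta13OfThm1CCM F 2 j ε₀ ε₂₉ B₃ B₃' a₀ a₁)) := by
  refine tokenFree_of_genericRoadAtWitness F
    (fun θ => ∃ γ₀ C δ₁ : ℝ, 0 < γ₀ ∧ γ₀ ≤ θ.γ ∧ 0 < δ₁ ∧
      (letI := θ.instVβ₁; letI := θ.instVβ₂; letI := θ.instιβ
       PolLimitsExistBox F (mergedTermFamilyMatT F 2 (TβOfRecord₁₃ F 2) (chiβOfRecord₁₃ F 2 θ) θ.εbg) θ.ρ8 θ.bV γ₀ ∧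
       (∀ k (v : Fin (k + 1) → ℝ), v ∈ Box γ₀ k → ∀ K (z : Fin 4 → ℤ), (∀ i, 2 * |z i| < ((F.P K).sitesPerDir (k + 1) : ℤ)) →
          |polWindow F K (k + 1) (mergedTermFamilyMatT F 2 (TβOfRecord₁₃ F 2) (chiβOfRecord₁₃ F 2 θ) θ.εbg k v K) θ.ρ8 θ.bV 0 1 z| ≤ C * Real.exp (-δ₁ * l1 z))))
    (fun θ hP => ?_) (fun a₀ ha₀ => ?_)
  · obtain ⟨γ₀, C, δ₁, hγ₀, hle, hδ, hL, hD⟩ := hP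
    obtain ⟨hlow, hup⟩ := absBox_betaOfRecord₁₃_of_fundamentalDomainDecayOnBox F 2 θ hle hδ hL hD
    exact ⟨γ₀, betaPrime510 4 C δ₁, hγ₀, hlow, hup⟩
  · obtain ⟨j, ε₀, ε₂₉, B₃, B₃', a₁, hε', γ₀, C, δ₁, hγ₀, hγh, hδ, hL, hD⟩ := h a₀ ha₀
    refine ⟨j, ε₀, ε₂₉, B₃, B₃', a₁, hε', γ₀, C, δ₁, hγ₀, ?_, hδ, hL, hD⟩
    rw [theta13OfThm1CCM_γ]; exact hγh

/-- **THE SAME BILL PAYS V19's REGISTERED 3ᴬ′** (p613354's `abs3A'_of_fundamentalDomainFaceAt` with its hypothesis weakened to one representative per threshold).  CONDITIONAL.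
[cite: Balaban1987RG1, Thm 1 p.259, (1.20)–(1.22) p.264, §1 p.264, (5.10) p.293; Balaban1989LargeFieldII, p.355] -/
theorem abs3A'V19_of_fundamentalDomainFaceAtOneWitness
    (h : ∀ a₀ : ℝ, 0 < a₀ → ∃ (j : ℕ) (ε₀ ε₂₉ B₃ B₃' a₁ : ℝ), 0 < ε₂₉ ∧ ∃ γ₀ C δ₁ : ℝ, 0 < γ₀ ∧ γ₀ ≤ 1 / 2 ∧ 0 < δ₁ ∧
      (letI := (theta13OfThm1CCM F 2 j ε₀ ε₂₉ B₃ B₃' a₀ a₁).instVβ₁; letI := (theta13OfThm1CCM F 2 j ε₀ ε₂₉ B₃ B₃' a₀ a₁).instVβ₂;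
       letI := (theta13OfThm1CCM F 2 j ε₀ ε₂₉ B₃ B₃' a₀ a₁).instιβ
       PolLimitsExistBox F
          (mergedTermFamilyMatT F 2 (TβOfRecord₁₃ F 2) (chiβOfRecord₁₃ F 2 (theta13OfThm1CCM F 2 j ε₀ ε₂₉ B₃ B₃' a₀ a₁)) (theta13OfThm1CCM F 2 j ε₀ ε₂₉ B₃ B₃' a₀ a₁).εbg)
          (theta13OfThm1CCM F 2 j ε₀ ε₂₉ B₃ B₃' a₀ a₁).ρ8 (theta13OfThm1CCM F 2 j ε₀ ε₂₉ B₃ B₃' a₀ a₁).bV γ₀ ∧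
       (∀ k (v : Fin (k + 1) → ℝ), v ∈ Box γ₀ k → ∀ K (z : Fin 4 → ℤ), (∀ i, 2 * |z i| < ((F.P K).sitesPerDir (k + 1) : ℤ)) →
          |polWindow F K (k + 1)
              (mergedTermFamilyMatT F 2 (TβOfRecord₁₃ F 2) (chiβOfRecord₁₃ F 2 (theta13OfThm1CCM F 2 j ε₀ ε₂₉ B₃ B₃' a₀ a₁)) (theta13OfThm1CCM F 2 j ε₀ ε₂₉ B₃ B₃' a₀ a₁).εbg k v K)
              (theta13OfThm1CCM F 2 j ε₀ ε₂₉ B₃ B₃' a₀ a₁).ρ8 (theta13OfThm1CCM F 2 j ε₀ ε₂₉ B₃ B₃' a₀ a₁).bV 0 1 z| ≤ C * Real.exp (-δ₁ * l1 z)))) :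
    AbsBetaBoxAtThm1WitnessCCMGenAt F :=
  absBetaBoxGenAt_of_tokenFree F (tokenFree_of_fundamentalDomainFaceAtOneWitness F h)

end FundamentalDomain

/-! ## §4  K0⁷ BY NAME from each one-witness bill, under V19's stub-1 text (p608905's token-free road) and under the V20-R stub-1 text (FILE 1 §6) -/

section ByName

/-- **★★ K0⁷ BY NAME FROM V19's STUB-1 TEXT AND THE KERNEL-LETTER BILL AT ONE WITNESS PER THRESHOLD** (p610322's `record13SepCoPHInhabited_of_stub1_of_kernelLettersAt_byName` with the weakened
hypothesis).  CONDITIONAL on `h1` and the letters; K0⁷ OPEN; a helper, not a closer. [cite: Balaban1985Variational, Thm 1 (8)–(9) p.279, Prop. 8 p.304; Balaban1985RegularSpaces, Prop. 6 p.99; Balaban1988Convergent, Thm 1 p.262; Balaban1987RG1, Thm 1 p.259, (1.18) p.263, (5.10) p.293; Balaban1988RG2Cluster, (2.13)–(2.14) pp.14–15] -/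
theorem record13SepCoPHInhabited_of_stub1_kernelLettersAtOneWitness_byName (h1 : ∀ F : T4Family, Prop8StepCoPAt F)
    (hK : ∀ (F : T4Family) (a₀ : ℝ), 0 < a₀ → ∃ (j : ℕ) (ε₀ ε₂₉ B₃ B₃' a₁ : ℝ), 0 < ε₂₉ ∧
      ∃ (ℓ : U3Letters₁₁) (κ C₉ ω : ℝ) (Λ : ℕ → ℕ → ℝ), 0 < κ ∧ 0 ≤ ω ∧ ω < 1 ∧
        NE9 ((objectsOfRecord₁₃ F 2 (theta13OfThm1CCM F 2 j ε₀ ε₂₉ B₃ B₃' a₀ a₁) ℓ).EA 0) (Window (theta13OfThm1CCM F 2 j ε₀ ε₂₉ B₃ B₃' a₀ a₁).γ) κ Λ ∧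
        T4OutputRate.FadingMemory C₉ ω Λ ∧
        KernelDecayOfRecord₁₃ F 2 (theta13OfThm1CCM F 2 j ε₀ ε₂₉ B₃ B₃' a₀ a₁) 0 1 κ) :
    Summit.QuantumFields.YangMills.Theses.BalabanUVNodes.Record13SepCoPHInhabited :=
  record13SepCoPHInhabited_of_stub1_tokenFreeCore_byName h1 fun F => tokenFree_of_kernelLettersAtOneWitness F (hK F)

/-- **★★ K0⁷ BY NAME FROM THE V20-R STUB-1 TEXT AND THE KERNEL-LETTER BILL AT ONE WITNESS PER THRESHOLD** (FILE 1's `record13SepCoPHInhabited_of_stub1R_tokenFree_byName`: p630277 + stub 2′ p595104).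
CONDITIONAL on `h1R` and the letters; K0⁷ OPEN; a helper, not a closer. [cite: Balaban1985Variational, Thm 1 (8)–(9) p.279, Prop. 8 p.304, p.304 lines 1–2; Balaban1985RegularSpaces, Prop. 6 p.99; Balaban1988Convergent, Thm 1 p.262; Balaban1987RG1, Thm 1 p.259, (1.18) p.263, (5.10) p.293; Balaban1988RG2Cluster, (2.13)–(2.14) pp.14–15] -/
theorem record13SepCoPHInhabited_of_stub1R_kernelLettersAtOneWitness_byName
    (h1R : ∀ F : T4Family, ∃ (c : ℕ) (B₃ a₀ a₁ : ℝ), 2 * (F.L : ℝ) ^ 2 ≤ B₃ ∧ 0 < a₀ ∧ 0 < a₁ ∧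
      Prop8RegSepTopStepR F 2 (fun ν K Ω => suppDomOfRecord F ν K Ω) c B₃ a₀ a₁)
    (hK : ∀ (F : T4Family) (a₀ : ℝ), 0 < a₀ → ∃ (j : ℕ) (ε₀ ε₂₉ B₃ B₃' a₁ : ℝ), 0 < ε₂₉ ∧
      ∃ (ℓ : U3Letters₁₁) (κ C₉ ω : ℝ) (Λ : ℕ → ℕ → ℝ), 0 < κ ∧ 0 ≤ ω ∧ ω < 1 ∧
        NE9 ((objectsOfRecord₁₃ F 2 (theta13OfThm1CCM F 2 j ε₀ ε₂₉ B₃ B₃' a₀ a₁) ℓ).EA 0) (Window (theta13OfThm1CCM F 2 j ε₀ ε₂₉ B₃ B₃' a₀ a₁).γ) κ Λ ∧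
        T4OutputRate.FadingMemory C₉ ω Λ ∧
        KernelDecayOfRecord₁₃ F 2 (theta13OfThm1CCM F 2 j ε₀ ε₂₉ B₃ B₃' a₀ a₁) 0 1 κ) :
    Summit.QuantumFields.YangMills.Theses.BalabanUVNodes.Record13SepCoPHInhabited :=
  record13SepCoPHInhabited_of_stub1R_tokenFree_byName h1R fun F => tokenFree_of_kernelLettersAtOneWitness F (hK F)


/-- **K0⁷ BY NAME FROM THE V20-R STUB-1 TEXT AND KERNEL LETTERS AT ONE SMALL-WINDOW WITNESS PER THRESHOLD** (§1's window edition).  CONDITIONAL; K0⁷ OPEN; a helper, not a closer.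
[cite: Balaban1985Variational, Thm 1 (8)–(9) p.279, Prop. 8 p.304, p.304 lines 1–2; Balaban1985RegularSpaces, Prop. 6 p.99; Balaban1988Convergent, Thm 1 p.262; Balaban1987RG1, Thm 1 p.255, (1.18) p.263, (5.10) p.293; Balaban1989LargeFieldII, (1.4) p.357] -/
theorem record13SepCoPHInhabited_of_stub1R_kernelLettersAtOneWindowWitness_byName
    (h1R : ∀ F : T4Family, ∃ (c : ℕ) (B₃ a₀ a₁ : ℝ), 2 * (F.L : ℝ) ^ 2 ≤ B₃ ∧ 0 < a₀ ∧ 0 < a₁ ∧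
      Prop8RegSepTopStepR F 2 (fun ν K Ω => suppDomOfRecord F ν K Ω) c B₃ a₀ a₁)
    (hK : ∀ (F : T4Family) (a₀ : ℝ), 0 < a₀ → ∃ (j : ℕ) (γ₀ ε₀ ε₂₉ B₃ B₃' a₁ : ℝ), 0 < γ₀ ∧ γ₀ ≤ 1 / 2 ∧ 0 < ε₂₉ ∧
      ∃ (ℓ : U3Letters₁₁) (κ C₉ ω : ℝ) (Λ : ℕ → ℕ → ℝ), 0 < κ ∧ 0 ≤ ω ∧ ω < 1 ∧
        NE9 ((objectsOfRecord₁₃ F 2 (theta13OfThm1CCMW F 2 j γ₀ ε₀ ε₂₉ B₃ B₃' a₀ a₁) ℓ).EA 0) (Window (theta13OfThm1CCMW F 2 j γ₀ ε₀ ε₂₉ B₃ B₃' a₀ a₁).γ) κ Λ ∧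
        T4OutputRate.FadingMemory C₉ ω Λ ∧
        KernelDecayOfRecord₁₃ F 2 (theta13OfThm1CCMW F 2 j γ₀ ε₀ ε₂₉ B₃ B₃' a₀ a₁) 0 1 κ) :
    Summit.QuantumFields.YangMills.Theses.BalabanUVNodes.Record13SepCoPHInhabited :=
  record13SepCoPHInhabited_of_stub1R_tokenFree_byName h1R fun F => tokenFree_of_kernelLettersAtOneWindowWitness F (hK F)

/-- **★★ K0⁷ BY NAME FROM V19's STUB-1 TEXT AND THE WINDOW-UNIFORM (5.10) BILL AT ONE WITNESS PER THRESHOLD** (p608074's `…_of_stub1_of_kernelDecayWindowUniformAt_byName`, weakened hypothesis).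
CONDITIONAL; K0⁷ OPEN; a helper, not a closer. [cite: Balaban1985Variational, Thm 1 (8)–(9) p.279, Prop. 8 p.304; Balaban1985RegularSpaces, Prop. 6 p.99; Balaban1988Convergent, Thm 1 p.262; Balaban1987RG1, Thm 1 p.259, §1 p.264, (5.10) p.293] -/
theorem record13SepCoPHInhabited_of_stub1_kernelDecayWindowUniformAtOneWitness_byName (h1 : ∀ F : T4Family, Prop8StepCoPAt F)
    (hdec : ∀ (F : T4Family) (a₀ : ℝ), 0 < a₀ → ∃ (j : ℕ) (ε₀ ε₂₉ B₃ B₃' a₁ : ℝ), 0 < ε₂₉ ∧ ∃ γ₀ C δ₁ : ℝ, 0 < γ₀ ∧ γ₀ ≤ 1 / 2 ∧ 0 < δ₁ ∧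
      (letI := (theta13OfThm1CCM F 2 j ε₀ ε₂₉ B₃ B₃' a₀ a₁).instVβ₁; letI := (theta13OfThm1CCM F 2 j ε₀ ε₂₉ B₃ B₃' a₀ a₁).instVβ₂;
       letI := (theta13OfThm1CCM F 2 j ε₀ ε₂₉ B₃ B₃' a₀ a₁).instιβ
       ∀ g ∈ Window γ₀, ∀ k : ℕ,
         Decay510 (kernelA F (mergedTermFamilyMatT F 2 (TβOfRecord₁₃ F 2) (chiβOfRecord₁₃ F 2 (theta13OfThm1CCM F 2 j ε₀ ε₂₉ B₃ B₃' a₀ a₁))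
           (theta13OfThm1CCM F 2 j ε₀ ε₂₉ B₃ B₃' a₀ a₁).εbg) (theta13OfThm1CCM F 2 j ε₀ ε₂₉ B₃ B₃' a₀ a₁).ρ8 (theta13OfThm1CCM F 2 j ε₀ ε₂₉ B₃ B₃' a₀ a₁).bV g k 0 1) C δ₁)) :
    Summit.QuantumFields.YangMills.Theses.BalabanUVNodes.Record13SepCoPHInhabited :=
  record13SepCoPHInhabited_of_stub1_tokenFreeCore_byName h1 fun F => tokenFree_of_kernelDecayWindowUniformAtOneWitness F (hdec F)

/-- **★★ K0⁷ BY NAME FROM THE V20-R STUB-1 TEXT AND THE WINDOW-UNIFORM (5.10) BILL AT ONE WITNESS PER THRESHOLD.**  CONDITIONAL; K0⁷ OPEN; a helper, not a closer.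
[cite: Balaban1985Variational, Thm 1 (8)–(9) p.279, Prop. 8 p.304, p.304 lines 1–2; Balaban1985RegularSpaces, Prop. 6 p.99; Balaban1988Convergent, Thm 1 p.262; Balaban1987RG1, Thm 1 p.259, §1 p.264, (5.10) p.293] -/
theorem record13SepCoPHInhabited_of_stub1R_kernelDecayWindowUniformAtOneWitness_byName
    (h1R : ∀ F : T4Family, ∃ (c : ℕ) (B₃ a₀ a₁ : ℝ), 2 * (F.L : ℝ) ^ 2 ≤ B₃ ∧ 0 < a₀ ∧ 0 < a₁ ∧
      Prop8RegSepTopStepR F 2 (fun ν K Ω => suppDomOfRecord F ν K Ω) c B₃ a₀ a₁)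
    (hdec : ∀ (F : T4Family) (a₀ : ℝ), 0 < a₀ → ∃ (j : ℕ) (ε₀ ε₂₉ B₃ B₃' a₁ : ℝ), 0 < ε₂₉ ∧ ∃ γ₀ C δ₁ : ℝ, 0 < γ₀ ∧ γ₀ ≤ 1 / 2 ∧ 0 < δ₁ ∧
      (letI := (theta13OfThm1CCM F 2 j ε₀ ε₂₉ B₃ B₃' a₀ a₁).instVβ₁; letI := (theta13OfThm1CCM F 2 j ε₀ ε₂₉ B₃ B₃' a₀ a₁).instVβ₂;
       letI := (theta13OfThm1CCM F 2 j ε₀ ε₂₉ B₃ B₃' a₀ a₁).instιβ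
       ∀ g ∈ Window γ₀, ∀ k : ℕ,
         Decay510 (kernelA F (mergedTermFamilyMatT F 2 (TβOfRecord₁₃ F 2) (chiβOfRecord₁₃ F 2 (theta13OfThm1CCM F 2 j ε₀ ε₂₉ B₃ B₃' a₀ a₁))
           (theta13OfThm1CCM F 2 j ε₀ ε₂₉ B₃ B₃' a₀ a₁).εbg) (theta13OfThm1CCM F 2 j ε₀ ε₂₉ B₃ B₃' a₀ a₁).ρ8 (theta13OfThm1CCM F 2 j ε₀ ε₂₉ B₃ B₃' a₀ a₁).bV g k 0 1) C δ₁)) :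
    Summit.QuantumFields.YangMills.Theses.BalabanUVNodes.Record13SepCoPHInhabited :=
  record13SepCoPHInhabited_of_stub1R_tokenFree_byName h1R fun F => tokenFree_of_kernelDecayWindowUniformAtOneWitness F (hdec F)

/-- **★★ K0⁷ BY NAME FROM V19's STUB-1 TEXT AND THE FUNDAMENTAL-DOMAIN BILL AT ONE WITNESS PER THRESHOLD** (p613354's `…_of_stub1_fundamentalDomainFaceAt_byName`, weakened hypothesis).
CONDITIONAL; K0⁷ OPEN; a helper, not a closer. [cite: Balaban1985Variational, Thm 1 (8)–(9) p.279, Prop. 8 p.304; Balaban1985RegularSpaces, Prop. 6 p.99; Balaban1988Convergent, Thm 1 p.262; Balaban1987RG1, Thm 1 p.259, §1 p.264, (5.10) p.293] -/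
theorem record13SepCoPHInhabited_of_stub1_fundamentalDomainFaceAtOneWitness_byName (h1 : ∀ F : T4Family, Prop8StepCoPAt F)
    (h : ∀ (F : T4Family) (a₀ : ℝ), 0 < a₀ → ∃ (j : ℕ) (ε₀ ε₂₉ B₃ B₃' a₁ : ℝ), 0 < ε₂₉ ∧ ∃ γ₀ C δ₁ : ℝ, 0 < γ₀ ∧ γ₀ ≤ 1 / 2 ∧ 0 < δ₁ ∧
      (letI := (theta13OfThm1CCM F 2 j ε₀ ε₂₉ B₃ B₃' a₀ a₁).instVβ₁; letI := (theta13OfThm1CCM F 2 j ε₀ ε₂₉ B₃ B₃' a₀ a₁).instVβ₂;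
       letI := (theta13OfThm1CCM F 2 j ε₀ ε₂₉ B₃ B₃' a₀ a₁).instιβ
       PolLimitsExistBox F
          (mergedTermFamilyMatT F 2 (TβOfRecord₁₃ F 2) (chiβOfRecord₁₃ F 2 (theta13OfThm1CCM F 2 j ε₀ ε₂₉ B₃ B₃' a₀ a₁)) (theta13OfThm1CCM F 2 j ε₀ ε₂₉ B₃ B₃' a₀ a₁).εbg)
          (theta13OfThm1CCM F 2 j ε₀ ε₂₉ B₃ B₃' a₀ a₁).ρ8 (theta13OfThm1CCM F 2 j ε₀ ε₂₉ B₃ B₃' a₀ a₁).bV γ₀ ∧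
       (∀ k (v : Fin (k + 1) → ℝ), v ∈ Box γ₀ k → ∀ K (z : Fin 4 → ℤ), (∀ i, 2 * |z i| < ((F.P K).sitesPerDir (k + 1) : ℤ)) →
          |polWindow F K (k + 1)
              (mergedTermFamilyMatT F 2 (TβOfRecord₁₃ F 2) (chiβOfRecord₁₃ F 2 (theta13OfThm1CCM F 2 j ε₀ ε₂₉ B₃ B₃' a₀ a₁)) (theta13OfThm1CCM F 2 j ε₀ ε₂₉ B₃ B₃' a₀ a₁).εbg k v K)
              (theta13OfThm1CCM F 2 j ε₀ ε₂₉ B₃ B₃' a₀ a₁).ρ8 (theta13OfThm1CCM F 2 j ε₀ ε₂₉ B₃ B₃' a₀ a₁).bV 0 1 z| ≤ C * Real.exp (-δ₁ * l1 z)))) :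
    Summit.QuantumFields.YangMills.Theses.BalabanUVNodes.Record13SepCoPHInhabited :=
  record13SepCoPHInhabited_of_stub1_tokenFreeCore_byName h1 fun F => tokenFree_of_fundamentalDomainFaceAtOneWitness F (h F)

/-- **★★ K0⁷ BY NAME FROM THE V20-R STUB-1 TEXT AND THE FUNDAMENTAL-DOMAIN BILL AT ONE WITNESS PER THRESHOLD.**  CONDITIONAL; K0⁷ OPEN; a helper, not a closer.
[cite: Balaban1985Variational, Thm 1 (8)–(9) p.279, Prop. 8 p.304, p.304 lines 1–2; Balaban1985RegularSpaces, Prop. 6 p.99; Balaban1988Convergent, Thm 1 p.262; Balaban1987RG1, Thm 1 p.259, §1 p.264, (5.10) p.293] -/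
theorem record13SepCoPHInhabited_of_stub1R_fundamentalDomainFaceAtOneWitness_byName
    (h1R : ∀ F : T4Family, ∃ (c : ℕ) (B₃ a₀ a₁ : ℝ), 2 * (F.L : ℝ) ^ 2 ≤ B₃ ∧ 0 < a₀ ∧ 0 < a₁ ∧
      Prop8RegSepTopStepR F 2 (fun ν K Ω => suppDomOfRecord F ν K Ω) c B₃ a₀ a₁)
    (h : ∀ (F : T4Family) (a₀ : ℝ), 0 < a₀ → ∃ (j : ℕ) (ε₀ ε₂₉ B₃ B₃' a₁ : ℝ), 0 < ε₂₉ ∧ ∃ γ₀ C δ₁ : ℝ, 0 < γ₀ ∧ γ₀ ≤ 1 / 2 ∧ 0 < δ₁ ∧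
      (letI := (theta13OfThm1CCM F 2 j ε₀ ε₂₉ B₃ B₃' a₀ a₁).instVβ₁; letI := (theta13OfThm1CCM F 2 j ε₀ ε₂₉ B₃ B₃' a₀ a₁).instVβ₂;
       letI := (theta13OfThm1CCM F 2 j ε₀ ε₂₉ B₃ B₃' a₀ a₁).instιβ
       PolLimitsExistBox F
          (mergedTermFamilyMatT F 2 (TβOfRecord₁₃ F 2) (chiβOfRecord₁₃ F 2 (theta13OfThm1CCM F 2 j ε₀ ε₂₉ B₃ B₃' a₀ a₁)) (theta13OfThm1CCM F 2 j ε₀ ε₂₉ B₃ B₃' a₀ a₁).εbg)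
          (theta13OfThm1CCM F 2 j ε₀ ε₂₉ B₃ B₃' a₀ a₁).ρ8 (theta13OfThm1CCM F 2 j ε₀ ε₂₉ B₃ B₃' a₀ a₁).bV γ₀ ∧
       (∀ k (v : Fin (k + 1) → ℝ), v ∈ Box γ₀ k → ∀ K (z : Fin 4 → ℤ), (∀ i, 2 * |z i| < ((F.P K).sitesPerDir (k + 1) : ℤ)) →
          |polWindow F K (k + 1)
              (mergedTermFamilyMatT F 2 (TβOfRecord₁₃ F 2) (chiβOfRecord₁₃ F 2 (theta13OfThm1CCM F 2 j ε₀ ε₂₉ B₃ B₃' a₀ a₁)) (theta13OfThm1CCM F 2 j ε₀ ε₂₉ B₃ B₃' a₀ a₁).εbg k v K)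
              (theta13OfThm1CCM F 2 j ε₀ ε₂₉ B₃ B₃' a₀ a₁).ρ8 (theta13OfThm1CCM F 2 j ε₀ ε₂₉ B₃ B₃' a₀ a₁).bV 0 1 z| ≤ C * Real.exp (-δ₁ * l1 z)))) :
    Summit.QuantumFields.YangMills.Theses.BalabanUVNodes.Record13SepCoPHInhabited :=
  record13SepCoPHInhabited_of_stub1R_tokenFree_byName h1R fun F => tokenFree_of_fundamentalDomainFaceAtOneWitness F (h F)

end ByName

end Summit.QuantumFields.YangMills.Theorems.K0Stub3V20CurrencyRoads

end
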